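import Summits.QuantumFields.BalabanUV.T4Continuum.Support.NE7HdecompOfNL0
import Summits.QuantumFields.BalabanUV.T4Continuum.Support.NE7DecompOfLettersGenericFixed
import Summits.QuantumFields.BalabanUV.T4Continuum.Support.NE7PairResidualSupRep
import Summits.QuantumFields.BalabanUV.T4Continuum.Support.NE7SliceFrameMatchingLimit
import Summits.QuantumFields.BalabanUV.T4Continuum.Support.NE3RightInverseSupLetters
import HarnessLib

/-!
# NE7PairDecompNL0 — THE SLICE DECOMPOSITION OF AN ARBITRARY ADMISSIBLE PAIR (d = 4, L = 2): gen 104's `NE7HdecompOfNL0.hdecomp_of_nl0` RE-ISSUED FOR ANY two admissible configurations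
# `U♯, U′` of the same level over the same datum — no interior radius, no tangent-criticality of `U♯`, the residual near-representative SUPPLIED (gen 94's `pair_residual_sup_rep`) — with
# the gauge's PERIODICITY and the slice part's ACCUMULATED-FRAME BOUND `‖framePotW X_T‖ ≤ frameC·C_S·ε` kept in the conclusion

Cell `pub-balaban`, rung (B)+1 sub-cell t4, lineage `b2b-balaban-t4-ne7-p1`, generation 105 (CRUX PROVER NE7 #1 = OWNER of BINDER row NE7).  Memo `t4/b2b-balaban-t4-ne7-p1-g105/ROAD-G105.md` §1.
WHY.  The proof of `hdecomp_of_nl0` uses, of its binder list, only: `U♯, U′ ∈ admissible (sfClass 4 2 N ε) 2 (k+1) D` and the near-representative `u₀`; the datum's unitarity∕periodicity∕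
smallness, the interior radius `ε∕(8M²)` of `U♯` and its tangent-criticality are IDLE there (they belong to the (8)∃ END's binder shape).  Node NE3's re-typed root T-E_w♯ (this
generation's assembly `NE7EnergyRateWSU2`) applies the decomposition to the pair (`U♯ := cavg U_B`, `U′ := U_A`) of a block-averaged finer minimiser and a coarser minimiser, where
`U♯` is only APPROXIMATELY critical — hence this re-issue.  The two extra conclusions are read off the (R1″) representative: the gauge is `slice_representative_nl0`'s (periodic), and
`X_T = X − R₀φ̃` has `framePotW X_T = framePotW X` (`NE7FrameFreeRightInverse.framePotW_rightInvW0`, `NE7SliceFrameMatchingLimit.framePotW_sub`), `≤ frameC·M·sup‖X‖`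
(`NE3RightInverseSupLetters.norm_framePotW_le_of_sup`) `= frameC·C_S·ε`.
WHAT ([folklore]; 0 def, 0 sorry).  **`decomp_of_nl0_pair`**: k-free `ε₂, C_S > 0`, `ν_c, κ_c ≥ 0` (gen 104's) such that for `0 < ε ≤ ε₂` with `10²¹·card n·ε ≤ 1`, every `N ≥ 1`,
datum `D`, level `k+1` (`M = 2^{k+1}`) and admissible `U♯, U′` over `D`: a unitary `(N·M)`-periodic gauge `u`, `U′^{u} = U♯·e^{X}`, `X` skew `(N·M)`-periodic, `sup‖X‖·M ≤ C_S·ε`,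
`X = X_T + X_N`, `X_T ∈ 𝒯_E(U♯)`, `‖framePotW 2 (k+1) U♯ X_T z‖ ≤ frameC 4 2·C_S·ε`, `X_N` skew, `‖X_N‖_w ≤ ν‖X‖_w`, `(ε∕M²)Σ_{perWin}‖curl U♯ X_N‖ ≤ κ‖X‖_w²`, `ν ≤ ν_c·ε`,
`κ ≤ κ_c·ε`.  Proof = gen 104's composition verbatim ((S1)-NL0 `slice_representative_nl0`, (S2)-NL0 direct letters, `R₀`'s ℓ-letters over row NE7b's frame masses p779495) with
`decomp_of_letters_fixed` as the junction.  (`n : Type`, as in gen 94's `NE7PairResidualSupRep`.)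
HONEST FRAMING (page 1): composition of landed kernel theorems of this lineage and of [B7]∕[B8] AS TYPED in the tree; nothing of Bałaban's asserted as an axiom; NOT T-E_w♯ (next files), NOT
NE3, NOT NE7; spine count unchanged; finite T⁴ rung (B)+1 — NOT infinite volume, NOT mass gap, NOT BetaPertH, NOT Clay (continuum YM on T⁴ ⇐ BetaPertH ∧ nine spine estimates).
-/

set_option autoImplicit false

open scoped BigOperators Matrix Matrix.Norms.L2Operator
open NormedSpace Finset Set

namespace Summit.QuantumFields.BalabanUV.T4Continuum.NE7PairDecompNL0


open Literature.MathematicalPhysics.QuantumFieldTheory.Balaban1983to89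
open B7Prop1Explicit B7Prop2Explicit B7Prop3Flat MatrixLog
open B7Eq92Concrete (vcov)
open T4AveragingDeficitWall (IsUnitaryCfg IsSkewDir SmallField vary curl curlSq dirSq dirL1)
open T4AveragingDeficitWallBoundary (IsPeriodicCfg periodBox)
open AveragingDeficitPeriodicCounting (IsPeriodicDir)
open AveragingDeficitTwoLevelPrep (prop1Radius)
open AveragingDeficitMultiLevelPrep (LevelSmall tower TangentIter cavgIter)
open AveragingDeficitMultiLevelBridge (cavgIter_eq_avgIter)
open MinimalActionLevels (perWin)
open MinimalActionSandwich (admissible)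
open MinimalActionRate (sfClass)
open ReplicationRightInverseBound (radSum)
open BlockAverageVaryHolo (nbRad)
open NE3HessForm (dAction)
open NE3EnergyShapes (IsUnitarySite IsPeriodicSite)
open NE3EnergyWeightedShapes (energyNormW energyNormW_nonneg)
open NE3QbarIterCovLiftPrep (cruxC liftC liftC_nonneg)
open NE3RightInverseSupLetters (frameC)
open NE3RightInverseSolveLetters (thetaLoc thetaLoc_nonneg l1Ball)
open NE3FrameGenLocal (frameRad)
open NE3RightInverseL2Letter (l2C l2C_nonneg)
open NE3HatInvCurlLetters (curl2C curl1C curl2C_nonneg curl1C_nonneg)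
open NE3CovariantLineSumsError (Csup)
open ShellMeasureAverageProp4General (C1cov C1cov_pos)
open NE3FramePotBoundW (tower_eq_pow_mul)
open NE3TangentCovariantTower (framePotW)
open NE3.PairLandauB8Avg (relPert)
open NE7MeanZeroGaugeSliceW (energyBlockLandauW)
open SpreadLift (loopRad)
open NE7FrameFreeRightInverse (rightInvW0 frameC_nonneg)
open NE7FrameFreeRightInverseLetters (dirSq_rightInvW0_le curlSq_rightInvW0_le sum_norm_curl_rightInvW0_le)
open NE7RightInverseFrameLetters (sum_normSq_framePotW_rightInvW_le sum_norm_framePotW_rightInvW_le)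
open NE7SliceIterationState (repLog cornerLog)
open NE7SliceIterationStateNL (coarseDatumNL)
open NE7SliceIterationStateFacts (repLog_skew repLog_periodic)
open NE7SliceRepresentativeNL0 (slice_representative_nl0)
open NE7SliceDirectLettersNL0 (directLetter_L1_nl0 directLetter_L2_nl0)
open NE7DecompOfLettersGeneric (decomp_of_letters)

open NE7DecompOfLettersGenericFixed (decomp_of_letters_fixed)
open NE7PairResidualSupRep (pair_residual_sup_rep)
open NE7FrameFreeRightInverse (framePotW_rightInvW0)
open NE7SliceFrameMatchingLimit (framePotW_sub)
open NE3RightInverseSupLetters (norm_framePotW_le_of_sup)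

noncomputable section

variable {n : Type} [Fintype n] [DecidableEq n]

set_option maxHeartbeats 800000 in
/-- **THE SLICE DECOMPOSITION OF AN ARBITRARY ADMISSIBLE PAIR** (`d = 4`, `L = 2`; statement in the file header): gen 104's `hdecomp♭` body for ANY admissible `U♯, U′` over a common datum,
with the near-representative supplied, the gauge periodic and the slice part's accumulated frame bounded by `frameC·C_S·ε`. [folklore] -/
theorem decomp_of_nl0_pair [Nonempty n] :
    ∃ ε₂ : ℝ, 0 < ε₂ ∧ ∃ CS : ℝ, 0 < CS ∧ ∃ νc : ℝ, 0 ≤ νc ∧ ∃ κc : ℝ, 0 ≤ κc ∧ ∀ (N : ℕ) [NeZero N] (ε : ℝ), 0 < ε → ε ≤ ε₂ →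
      1000000000000000000000 * (Fintype.card n : ℝ) * ε ≤ 1 →
      ∀ (D : Site 4 → Fin 4 → (Matrix n n ℂ)ˣ) (k : ℕ),
        ∀ Us ∈ admissible (sfClass 4 2 N ε) 2 (k + 1) D, ∀ U' ∈ admissible (sfClass 4 2 N ε) 2 (k + 1) D,
        ∃ (u : Site 4 → (Matrix n n ℂ)ˣ) (X XT XN : Site 4 → Fin 4 → Matrix n n ℂ) (α ν κ : ℝ),
          IsUnitarySite u ∧ IsPeriodicSite u ((N * 2 ^ (k + 1) : ℕ) : ℤ) ∧ IsSkewDir X ∧ IsPeriodicDir X ((N * 2 ^ (k + 1) : ℕ) : ℤ) ∧ 0 ≤ α ∧ (∀ x μ, ‖X x μ‖ ≤ α) ∧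
          gaugeAct u U' = vary Us X 1 ∧
          X = XT + XN ∧ XT ∈ energyBlockLandauW (d := 4) (n := n) 2 N (k + 1) Us ∧
          (∀ z : Site 4, ‖framePotW 2 (k + 1) Us XT z‖ ≤ frameC 4 2 * (CS * ε)) ∧ IsSkewDir XN ∧ 0 ≤ ν ∧
          energyNormW 2 (k + 1) Us XN (periodBox (d := 4) (N * 2 ^ (k + 1)))
            ≤ ν * energyNormW 2 (k + 1) Us X (periodBox (d := 4) (N * 2 ^ (k + 1))) ∧
          ε / (((2 : ℕ) : ℝ) ^ (k + 1)) ^ 2 * (∑ p ∈ perWin 4 (N * 2 ^ (k + 1)), ‖curl Us XN p‖)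
            ≤ κ * energyNormW 2 (k + 1) Us X (periodBox (d := 4) (N * 2 ^ (k + 1))) ^ 2 ∧
          α * ((2 : ℕ) : ℝ) ^ (k + 1) ≤ CS * ε ∧ ν ≤ νc * ε ∧ κ ≤ κc * ε := by
  obtain ⟨ε₂, hε₂, CS, hCS, α₀, hα₀, hα1, hα2, hrep⟩ := slice_representative_nl0 (n := n) (d := 3) (by norm_num) (le_refl 2) (bh := 10000000000000000000000000000000000) (by norm_num)
  -- the k-free letters at `d = 4`, `L = 2`
  obtain ⟨K₁, hK₁⟩ : ∃ K₁ : ℝ, K₁ = C1cov 4 * ((2 : ℕ) : ℝ) ^ 2 * Real.sqrt (((4 : ℕ) : ℝ) * (2 * (2 * ((2 : ℕ) : ℝ)) + 1) ^ 4) := ⟨_, rfl⟩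
  have hK₁0 : 0 ≤ K₁ := by rw [hK₁]; have := C1cov_pos 4; positivity
  obtain ⟨q₁, hq₁⟩ : ∃ q₁ : ℝ, q₁ = 64 * (C1cov 4 * ((2 : ℕ) : ℝ) ^ 2 * (((4 : ℕ) : ℝ) * (2 * (2 * ((2 : ℕ) : ℝ)) + 1) ^ 4)) * (((2 : ℕ) : ℝ) ^ 4 / ((2 : ℕ) : ℝ) ^ 2) := ⟨_, rfl⟩
  have hq₁0 : 0 ≤ q₁ := by rw [hq₁]; have := C1cov_pos 4; positivity
  obtain ⟨CΘ₂, hCΘ₂⟩ : ∃ CΘ₂ : ℝ, CΘ₂ = (2 : ℝ) ^ 4 * ((frameC 4 2 * liftC 4) ^ 2 * ((l1Ball (frameRad 4 2) : Finset (Site 4))).card) := ⟨_, rfl⟩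
  have hCΘ₂0 : 0 ≤ CΘ₂ := by rw [hCΘ₂]; positivity
  obtain ⟨CΘ₁, hCΘ₁⟩ : ∃ CΘ₁ : ℝ, CΘ₁ = (2 : ℝ) ^ 4 * (frameC 4 2 * liftC 4 * ((l1Ball (frameRad 4 2) : Finset (Site 4))).card) := ⟨_, rfl⟩
  have hCΘ₁0 : 0 ≤ CΘ₁ := by rw [hCΘ₁]; have := liftC_nonneg 4; have := frameC_nonneg 4 2; positivity
  obtain ⟨P, hP⟩ : ∃ P : ℝ, P = (Fintype.card (T4AveragingDeficitWall.Plane 4) : ℝ) := ⟨_, rfl⟩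
  have hP0 : 0 ≤ P := by rw [hP]; positivity
  have hl2 := l2C_nonneg 4 2
  have hc2 := curl2C_nonneg 4 2
  have hc1 := curl1C_nonneg 4 2
  -- the ceilings
  obtain ⟨A₁, hA₁⟩ : ∃ A₁ : ℝ, A₁ = 4 * (2 * l2C 4 2 + 2 * (16 * ((4 : ℕ) : ℝ) ^ 3 * ((64 : ℝ) ^ 4) ^ 2 * CΘ₂)) := ⟨_, rfl⟩
  obtain ⟨A₂, hA₂⟩ : ∃ A₂ : ℝ, A₂ = 4 * (2 * curl2C 4 2 + 2 * (16 * P * ((64 : ℝ) ^ 4) ^ 2 * CΘ₂)) := ⟨_, rfl⟩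
  obtain ⟨A₃, hA₃⟩ : ∃ A₃ : ℝ, A₃ = 2 * curl1C 4 2 + 2 * (4 * P * (64 : ℝ) ^ 4 * CΘ₁) := ⟨_, rfl⟩
  have hA₁0 : 0 ≤ A₁ := by rw [hA₁]; positivity
  have hA₂0 : 0 ≤ A₂ := by rw [hA₂]; positivity
  have hA₃0 : 0 ≤ A₃ := by rw [hA₃]; positivity
  refine ⟨ε₂, hε₂, CS, hCS, Real.sqrt (A₁ + A₂) * (32 * K₁ * CS), by positivity, A₃ * q₁, by positivity, ?_⟩
  intro N _ ε hε hεle hθline D k Us hUs U' hU'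
  have hN : 1 ≤ N := Nat.one_le_iff_ne_zero.mpr (NeZero.ne N)
  -- gen 94's residual near-representative of the pair
  have hηpos : 0 < ε / (((2 : ℕ) : ℝ) ^ (k + 1)) ^ 2 := by positivity
  have hθ' : 1000000000000000000000 * (Fintype.card n : ℝ) * (((2 : ℝ) ^ (k + 1)) ^ 2 * (ε / (((2 : ℕ) : ℝ) ^ (k + 1)) ^ 2)) ≤ 1 := by
    have hid : ((2 : ℝ) ^ (k + 1)) ^ 2 * (ε / (((2 : ℕ) : ℝ) ^ (k + 1)) ^ 2) = ε := by push_cast; field_simp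
    rw [hid]; exact hθline
  have hUs' : IsUnitaryCfg Us ∧ IsPeriodicCfg Us ((N * 2 ^ (k + 1) : ℕ) : ℤ) ∧ SmallField Us (ε / (((2 : ℕ) : ℝ) ^ (k + 1)) ^ 2) := hUs.1
  have hU'' : IsUnitaryCfg U' ∧ IsPeriodicCfg U' ((N * 2 ^ (k + 1) : ℕ) : ℤ) ∧ SmallField U' (ε / (((2 : ℕ) : ℝ) ^ (k + 1)) ^ 2) := hU'.1
  have htop₀ : cavgIter 2 (k + 1) U' = cavgIter 2 (k + 1) Us := by
    rw [cavgIter_eq_avgIter, cavgIter_eq_avgIter, hU'.2, hUs.2]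
  obtain ⟨u₀, hu₀, hu₀P, hpin, hclose⟩ :=
    pair_residual_sup_rep hU''.1 hUs'.1 hN hU''.2.1 hUs'.2.1 hηpos hU''.2.2 hUs'.2.2 htop₀ hθ'
  -- the pair's class data
  have hT : (tower 2 N (k + 1) : ℕ) = N * 2 ^ (k + 1) := by rw [tower_eq_pow_mul, Nat.mul_comm]
  obtain ⟨⟨hWu, hWP, hWx⟩, hWavg⟩ := hUs
  obtain ⟨⟨hU'u, hU'P, hU'x⟩, hU'avg⟩ := hU'
  have hWPt : IsPeriodicCfg Us ((tower 2 N (k + 1) : ℕ) : ℤ) := by rw [hT]; exact hWP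
  have hU'Pt : IsPeriodicCfg U' ((tower 2 N (k + 1) : ℕ) : ℤ) := by rw [hT]; exact hU'P
  have htop : cavgIter 2 (k + 1) U' = cavgIter 2 (k + 1) Us := by rw [cavgIter_eq_avgIter, cavgIter_eq_avgIter, hU'avg, hWavg]
  have hu₀Pt : IsPeriodicSite u₀ ((tower 2 N (k + 1) : ℕ) : ℤ) := by rw [hT]; exact hu₀P
  have hpin' : ∀ z : Site 4, u₀ ((((2 : ℕ) : ℤ)) ^ (k + 1) • z) = 1 := fun z => by
    have h := hpin z; rwa [Nat.cast_pow] at h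
  have hclose' : ∀ (x : Site 4) (μ : Fin 4), ‖(((Us x μ)⁻¹ * gaugeAct u₀ U' x μ : (Matrix n n ℂ)ˣ) : Matrix n n ℂ) - 1‖
      ≤ 10000000000000000000000000000000000 * ((2 : ℕ) : ℝ) ^ (k + 1) * (ε / (((2 : ℕ) : ℝ) ^ (k + 1)) ^ 2) := fun x μ => by
    have h := hclose x μ; rwa [show (2 : ℝ) = ((2 : ℕ) : ℝ) by norm_num] at h
  -- (S1)-NL0: the representative and the regime facts
  obtain ⟨hsk, hsk1, hθ, hθl, hθl2, hε1, hE, h52, hexpS, hc₃S, hsmS, hKS, hS1, hS4, u, hu, huP, hgauge, hXM, hcorner, hh, ⟨hφs, hφP⟩, hslice, hv0⟩ :=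
    hrep k N Us U' ε hε hεle hWu hWPt hWx hU'u hU'Pt hU'x hu₀ hu₀Pt hpin' hclose'
  -- sizes of the representative
  have hM0 : (0 : ℝ) < ((2 : ℕ) : ℝ) ^ (k + 1) := by positivity
  have hM1 : (1 : ℝ) ≤ ((2 : ℕ) : ℝ) ^ (k + 1) := one_le_pow₀ (by norm_num)
  have hx : 0 ≤ ε / (((2 : ℕ) : ℝ) ^ (k + 1)) ^ 2 := by positivity
  have hbS : 0 ≤ CS * ε / ((2 : ℕ) : ℝ) ^ (k + 1) := by positivity
  have hsup : ∀ (y : Site 4) (κ : Fin 4), ‖repLog Us U' u y κ‖ ≤ CS * ε / ((2 : ℕ) : ℝ) ^ (k + 1) := fun y κ => by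
    rw [le_div_iff₀ hM0, mul_comm]; exact hXM y κ
  have hX8 : ∀ (y : Site 4) (κ : Fin 4), ‖repLog Us U' u y κ‖ ≤ 1 / 8 := fun y κ =>
    (hsup y κ).trans ((div_le_self (by positivity) hM1).trans (by linarith only [hS4]))
  have hXs := repLog_skew hWu U' hU'u hu hgauge hX8
  have hXP : IsPeriodicDir (repLog Us U' u) ((N * 2 ^ (k + 1) : ℕ) : ℤ) := by rw [← hT]; exact repLog_periodic k N U' hWPt hU'Pt huP
  -- (S2)-NL0: the two direct letters at the representative
  have hDL1 := directLetter_L1_nl0 (le_refl 2) k hWu hWPt hx hsk hWx hα₀ hα1 hα2 h52 hbS hexpS hc₃S hsmS hKS U' hU'u hU'Pt hx hsk hU'x htop hu huP hgauge hX8 hsup hcorner hv0 hN hS1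
  have hDL2 := directLetter_L2_nl0 (le_refl 2) k hWu hWPt hx hsk hWx hα₀ hα1 hα2 h52 hbS hexpS hc₃S hsmS hKS U' hU'u hU'Pt hx hsk hU'x htop hu huP hgauge hX8 hsup hcorner hv0 hN
  -- the `R₀`-letters with row NE7b's frame masses
  have hΘ₂ := sum_normSq_framePotW_rightInvW_le (le_refl 2) k hWu hx hsk hWx N hθ hθl hWPt hφs
  have hΘ₁ := sum_norm_framePotW_rightInvW_le (le_refl 2) k hWu hx hsk hWx N hθ hθl hWPt hφs
  have hR1 := dirSq_rightInvW0_le (le_refl 2) k hWu hx hsk hWx N hθ hE hWPt hθl hε1 hφs (by norm_num) hΘ₂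
  have hR2 := curlSq_rightInvW0_le (le_refl 2) k hWu hx hsk hWx N hθ hE hWPt hθl hε1 hφs hΘ₂
  have hR3 := sum_norm_curl_rightInvW0_le (le_refl 2) k hWu hx hsk hWx N hθ hE hWPt hθl hε1 hφs hΘ₁
  -- the radius identity and `1/(1 − θ_loc ε) ≤ 2`
  have hid : (((2 : ℕ) : ℝ) ^ (k + 1)) ^ 2 * (ε / (((2 : ℕ) : ℝ) ^ (k + 1)) ^ 2) = ε := by field_simp
  rw [hid] at hθl hθl2 hε1 hΘ₂ hΘ₁ hR1 hR2 hR3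
  have h1θ : 1 / 2 ≤ 1 - thetaLoc 4 2 * ε := by linarith only [hθl2]
  have hinv1 : 1 / (1 - thetaLoc 4 2 * ε) ≤ 2 := by rw [div_le_iff₀ (by linarith only [h1θ])]; linarith only [h1θ]
  have hinv2 : 1 / (1 - thetaLoc 4 2 * ε) ^ 2 ≤ 4 := by
    rw [div_le_iff₀ (by positivity)]; nlinarith only [h1θ]
  have hinv0 : 0 ≤ 1 / (1 - thetaLoc 4 2 * ε) := by positivity
  -- constants of the three letters in the generic shape
  set M : ℝ := ((2 : ℕ) : ℝ) ^ (k + 1) with hM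
  have hMne : M ≠ 0 := hM0.ne'
  set Dφ : ℝ := dirSq (coarseDatumNL 2 k Us U' u) (periodBox (d := 4) N) with hDφ
  set Lφ : ℝ := dirL1 (coarseDatumNL 2 k Us U' u) (periodBox (d := 4) N) with hLφ
  have hDφ0 : 0 ≤ Dφ := by rw [hDφ]; unfold dirSq; positivity
  have hLφ0 : 0 ≤ Lφ := by rw [hLφ]; unfold dirL1; positivity
  set c₁ : ℝ := 2 * (l2C 4 2 / (1 - thetaLoc 4 2 * ε) ^ 2) + 2 * (16 * ((4 : ℕ) : ℝ) ^ 3 * ((64 : ℝ) ^ 4) ^ 2 * (CΘ₂ / (1 - thetaLoc 4 2 * ε) ^ 2)) with hc₁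
  set c₂ : ℝ := 2 * (curl2C 4 2 / (1 - thetaLoc 4 2 * ε) ^ 2) + 2 * (16 * P * ((64 : ℝ) ^ 4) ^ 2 * ε ^ 2 * (CΘ₂ / (1 - thetaLoc 4 2 * ε) ^ 2)) with hc₂
  set c₃ : ℝ := curl1C 4 2 / (1 - thetaLoc 4 2 * ε) + 4 * P * (64 : ℝ) ^ 4 * ε * (CΘ₁ / (1 - thetaLoc 4 2 * ε)) with hc₃
  have hc₁0 : 0 ≤ c₁ := by positivity
  have hc₂0 : 0 ≤ c₂ := by positivity
  have hc₃0 : 0 ≤ c₃ := by positivity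
  have hR1' : dirSq (rightInvW0 (le_refl 2) k hWu hx hsk hWx N hθ hE hφs) (periodBox (d := 4) (N * 2 ^ (k + 1))) ≤ c₁ * (M ^ 4 / M ^ 2) * Dφ := by
    refine hR1.trans (le_of_eq ?_)
    rw [hc₁, hCΘ₂]; ring
  have hR2' : curlSq Us (rightInvW0 (le_refl 2) k hWu hx hsk hWx N hθ hE hφs) (periodBox (d := 4) (N * 2 ^ (k + 1))) ≤ c₂ * (M ^ 4 / M ^ 4) * Dφ := by
    refine hR2.trans (le_of_eq ?_)
    rw [hc₂, hCΘ₂, hP]; ring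
  have hR3' : ∑ p ∈ perWin 4 (N * 2 ^ (k + 1)), ‖curl Us (rightInvW0 (le_refl 2) k hWu hx hsk hWx N hθ hE hφs) p‖ ≤ c₃ * (M ^ 4 / M ^ 2) * Lφ := by
    refine hR3.trans (le_of_eq ?_)
    rw [hc₃, hCΘ₁, hP]; ring
  -- the direct letters in the generic shape
  set EX : ℝ := energyNormW 2 (k + 1) Us (repLog Us U' u) (periodBox (d := 4) (N * 2 ^ (k + 1))) with hEX
  have hq₂sq : 1024 * (C1cov 4 * ((2 : ℕ) : ℝ) ^ 2 * Real.sqrt (((4 : ℕ) : ℝ) * (2 * (2 * ((2 : ℕ) : ℝ)) + 1) ^ 4)) ^ 2 * (((2 : ℕ) : ℝ) ^ 4 / ((2 : ℕ) : ℝ) ^ 4) * (M * (CS * ε / M)) ^ 2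
      = (32 * K₁ * (CS * ε)) ^ 2 := by
    rw [hK₁]; field_simp; ring
  have hDL2' : M ^ 4 / M ^ 4 * Dφ ≤ (32 * K₁ * (CS * ε)) ^ 2 * EX ^ 2 := by rw [← hq₂sq]; exact hDL2
  have hDL1' : M ^ 4 / M ^ 4 * Lφ ≤ q₁ * EX ^ 2 := by rw [hq₁]; exact hDL1
  -- the accumulated frame of the slice part: `framePotW (X − R₀φ̃) = framePotW X` (R₀ is frame-free), `≤ frameC·M·sup‖X‖ = frameC·C_S·ε`
  have hframe : ∀ (hφ : IsSkewDir (coarseDatumNL 2 k Us U' u)) (z : Site 4),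
      ‖framePotW 2 (k + 1) Us (fun y μ => repLog Us U' u y μ - rightInvW0 (le_refl 2) k hWu hx hsk hWx N hθ hE hφ y μ) z‖ ≤ frameC 4 2 * (CS * ε) := by
    intro hφ z
    rw [framePotW_sub (le_refl 2) k hWu hx hsk hWx, framePotW_rightInvW0 (le_refl 2) k hWu hx hsk hWx N hθ hE hφ hWPt 0 z, sub_zero]
    refine (norm_framePotW_le_of_sup (le_refl 2) k hWu hx hsk hWx (repLog Us U' u) hbS hsup z).trans (le_of_eq ?_)
    rw [← hM]; field_simp
  -- the junction: the two weighted letters of the normal part `R₀φ̃`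
  obtain ⟨hXdec, hXN, hν, hN1, hN2⟩ :=
    decomp_of_letters_fixed (d := 4) (L := 2) (N := N) k hε (Us := Us)
      (fun j W => energyBlockLandauW (d := 4) (n := n) 2 N (j + 1) W) (fun Y hY => hY.1) (φ := coarseDatumNL 2 k Us U' u)
      (q₂ := 32 * K₁ * (CS * ε)) (q₁ := q₁) (c₁ := c₁) (c₂ := c₂) (c₃ := c₃) (by positivity) hc₁0 hc₂0 hc₃0
      hXs (hslice hWu hx hsk hWx hθ hE hφs) hR1' hR2' hR3' hDL2' hDL1'
  have huP' : IsPeriodicSite u ((N * 2 ^ (k + 1) : ℕ) : ℤ) := by rw [← hT]; exact huP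
  refine ⟨u, repLog Us U' u, _, _, CS * ε / ((2 : ℕ) : ℝ) ^ (k + 1), Real.sqrt (c₁ + c₂) * (32 * K₁ * (CS * ε)), ε * c₃ * q₁, hu, huP', hXs, hXP, hbS, hsup, hgauge,
    hXdec, hslice hWu hx hsk hWx hθ hE hφs, hframe hφs, hXN, hν, hN1, hN2, ?_, ?_, ?_⟩
  · rw [← hM]; exact le_of_eq (by field_simp)
  · -- `ν = √(c₁+c₂)·32K₁C_Sε ≤ √(A₁+A₂)·32K₁C_S·ε`
    have hε1' : ε ^ 2 ≤ 1 := by nlinarith only [hε.le, hε1]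
    have hc₁le : c₁ ≤ A₁ := by
      rw [hc₁, hA₁]
      have t1 : l2C 4 2 / (1 - thetaLoc 4 2 * ε) ^ 2 ≤ 4 * l2C 4 2 := by
        rw [div_eq_mul_one_div]; nlinarith only [hinv2, hl2, mul_nonneg hl2 (show (0:ℝ) ≤ 1 / (1 - thetaLoc 4 2 * ε) ^ 2 by positivity)]
      have t2 : CΘ₂ / (1 - thetaLoc 4 2 * ε) ^ 2 ≤ 4 * CΘ₂ := by
        rw [div_eq_mul_one_div]; nlinarith only [hinv2, hCΘ₂0, mul_nonneg hCΘ₂0 (show (0:ℝ) ≤ 1 / (1 - thetaLoc 4 2 * ε) ^ 2 by positivity)]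
      nlinarith only [t1, t2, hCΘ₂0]
    have hc₂le : c₂ ≤ A₂ := by
      rw [hc₂, hA₂]
      have t1 : curl2C 4 2 / (1 - thetaLoc 4 2 * ε) ^ 2 ≤ 4 * curl2C 4 2 := by
        rw [div_eq_mul_one_div]; nlinarith only [hinv2, hc2, mul_nonneg hc2 (show (0:ℝ) ≤ 1 / (1 - thetaLoc 4 2 * ε) ^ 2 by positivity)]
      have t2 : CΘ₂ / (1 - thetaLoc 4 2 * ε) ^ 2 ≤ 4 * CΘ₂ := by
        rw [div_eq_mul_one_div]; nlinarith only [hinv2, hCΘ₂0, mul_nonneg hCΘ₂0 (show (0:ℝ) ≤ 1 / (1 - thetaLoc 4 2 * ε) ^ 2 by positivity)]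
      have t3 : 16 * P * ((64 : ℝ) ^ 4) ^ 2 * ε ^ 2 * (CΘ₂ / (1 - thetaLoc 4 2 * ε) ^ 2) ≤ 16 * P * ((64 : ℝ) ^ 4) ^ 2 * 1 * (4 * CΘ₂) := by
        have h0 : 0 ≤ CΘ₂ / (1 - thetaLoc 4 2 * ε) ^ 2 := by positivity
        calc _ ≤ 16 * P * ((64 : ℝ) ^ 4) ^ 2 * 1 * (CΘ₂ / (1 - thetaLoc 4 2 * ε) ^ 2) := by gcongr
          _ ≤ _ := by gcongr
      nlinarith only [t1, t3]
    have hsq : Real.sqrt (c₁ + c₂) ≤ Real.sqrt (A₁ + A₂) := Real.sqrt_le_sqrt (by linarith only [hc₁le, hc₂le])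
    have h0 : 0 ≤ 32 * K₁ * (CS * ε) := by positivity
    calc Real.sqrt (c₁ + c₂) * (32 * K₁ * (CS * ε)) ≤ Real.sqrt (A₁ + A₂) * (32 * K₁ * (CS * ε)) := mul_le_mul_of_nonneg_right hsq h0
      _ = Real.sqrt (A₁ + A₂) * (32 * K₁ * CS) * ε := by ring
  · -- `κ = ε·c₃·q₁ ≤ (A₃ q₁)·ε`
    have hc₃le : c₃ ≤ A₃ := by
      rw [hc₃, hA₃]
      have t1 : curl1C 4 2 / (1 - thetaLoc 4 2 * ε) ≤ 2 * curl1C 4 2 := by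
        rw [div_eq_mul_one_div]; nlinarith only [hinv1, hc1, mul_nonneg hc1 hinv0]
      have t2 : CΘ₁ / (1 - thetaLoc 4 2 * ε) ≤ 2 * CΘ₁ := by
        rw [div_eq_mul_one_div]; nlinarith only [hinv1, hCΘ₁0, mul_nonneg hCΘ₁0 hinv0]
      have t3 : 4 * P * (64 : ℝ) ^ 4 * ε * (CΘ₁ / (1 - thetaLoc 4 2 * ε)) ≤ 4 * P * (64 : ℝ) ^ 4 * 1 * (2 * CΘ₁) := by
        have h0 : 0 ≤ CΘ₁ / (1 - thetaLoc 4 2 * ε) := by positivity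
        calc _ ≤ 4 * P * (64 : ℝ) ^ 4 * 1 * (CΘ₁ / (1 - thetaLoc 4 2 * ε)) := by gcongr
          _ ≤ _ := by gcongr
      nlinarith only [t1, t3]
    have h := mul_le_mul_of_nonneg_right hc₃le hq₁0
    calc ε * c₃ * q₁ = (c₃ * q₁) * ε := by ring
      _ ≤ (A₃ * q₁) * ε := mul_le_mul_of_nonneg_right h hε.le


end

end Summit.QuantumFields.BalabanUV.T4Continuum.NE7PairDecompNL0
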